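import Literature.AlgebraicGeometry.Frobenioids.Thm42OfPreStepsGeneral
import Literature.AlgebraicGeometry.Frobenioids.Thm49Assembly
import HarnessLib

/-!
# [FrdI] Theorem 4.9 AS TYPED (`PreFrobenioidData.Thm49` at `ofFunctor`) in print's generality (quasi-isotropic
# `C_i`), MODULO ONLY "`Ψ`, `Ψ⁻¹` preserve pre-steps" (Thm. 3.4 (ii)) — no hypothesis on the base categories
# beyond print's standard type (Def. 3.1 (i)(d))

Mochizuki, *The geometry of Frobenioids I: the general theory*, Kyushu J. Math. **62** (2008) 293–400,
§4, Theorem 4.9, statement p. 88 l. 33 – p. 89 l. 2, proof p. 89 l. 3 – p. 90 l. 54 [cite: MochizukiFrdI2008, Thm. 4.9 p.88].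

PROOF-ONLY file (cell abc-iut, layer L1, node `FrdI:Thm4.9`; seat abc-iut-w4-d105): seat abc-iut-w4-d109's assembly
`FrdI.T49.thm49_ofFunctor_of_isOfFSMType` / `thm49_ofFunctor_of_isOfFSMFFType2024` (`Thm49Assembly.lean`,
`Thm49AssemblyFSMFF2024.lean`) re-run with the base hypothesis (FSM / FSMFF-2024) replaced by the single transport
statement it serves to prove — "`Ψ` and `Ψ⁻¹` preserve pre-steps" (Thm. 3.4 (ii), first clause). The printed proof,
followed literally: "we may assume without loss of generality that `C₁`, `C₂` are of isotropic type [Thm. 3.4 (i),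
(ii); Rmk. 4.5.1]" — restriction `Ψ^istr : C₁^istr ⥲ C₂^istr` (pre-steps of `C^istr` are the pre-steps of `C`
between isotropic objects, `PreFrobenioid.isPreStep_istr_iff`), group-like objects along `Ψ` from pre-step
preservation (seat abc-iut-L1-t11's `FrdI.OfPreSteps.isGroupLikeObj_map` on `Ψ^istr` plus isotropic hulls); "by
passing to perfections" — the setting at THE perfections of the isotropifications from the PRINTED hypotheses
(`FrdI.T42.setting_perfection_asPrinted`, `Thm42OfPreStepsGeneral.lean`, seat abc-iut-w4-d105) with `(Ψ^istr)^pf`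
from `isFrobeniusCompatible_of_preservesPreSteps`; then verbatim as in seat abc-iut-w4-d109's files: rationality of
`C₁^istr` (Rmk. 4.5.1, `isRational_istr_of`) and of its perfection (Prop. 5.5 (iii), `isRational_perfection_of`),
Thm. 4.9 at the perfect-isotropic level (`exists_thm49_compat_perfect_primarySupp`, seat abc-iut-w4-d099 et al.),
descent along `Φ ↪ Φ^pf` (`nonempty_divisorMonoidIsoOver_of_perfection`) and extension along isotropic hulls
(`nonempty_divisorMonoidIsoOver_of_isotropic`, with `FrdI.isIsotropic_map` / `isIsotropicHull_map`, seat
abc-iut-L1-t13 — no base hypothesis).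

* `FrdI.T49.isGroupLikeObj_map_of_preservesPreSteps` — Thm. 3.4 (ii), group-like clause, quasi-isotropic type,
  from pre-step preservation;
* `FrdI.T49.thm49_ofFunctor_of_preservesPreSteps` — **the typed `Thm49` modulo "`Ψ`, `Ψ⁻¹` preserve pre-steps"**;
  the FSM / FSMFF-2024 theorems of seat abc-iut-w4-d109 are its instances at `FrdI.isPreStep_map_of_quasiIsotropic_of_isOfFSMType`
  / `…FSMFFType2024`, and a proof of Thm. 3.4 (ii)'s pre-step clause over print's 2008 FSMFF bases (GAP row G-L1d8-1)
  would instantiate it verbatim.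

No new definitions; no statement of the paper is strengthened; nothing here bears on [IUTchIII] Cor. 3.12.
-/

namespace Literature.AlgebraicGeometry.Frobenioids

namespace FrdI.T49

open CategoryTheory Opposite PreFrobenioidData

universe w v v' u u'

variable {D₁ : Type u} [Category.{v} D₁] {Φ₁ : D₁ᵒᵖ ⥤ CommMonCat.{w}} {C₁ : Type u'} [Category.{v'} C₁]
  {D₂ : Type u} [Category.{v} D₂] {Φ₂ : D₂ᵒᵖ ⥤ CommMonCat.{w}} {C₂ : Type u'} [Category.{v'} C₂]
  {F₁ : C₁ ⥤ ElemFrobenioid Φ₁} {F₂ : C₂ ⥤ ElemFrobenioid Φ₂}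

set_option backward.isDefEq.respectTransparency false in
/-- **Thm. 3.4 (ii), group-like objects, quasi-isotropic type, from pre-step preservation**: if `Ψ` and `Ψ⁻¹`
preserve pre-steps then `Ψ` carries group-like objects to group-like objects. Proof: the isotropic hull
`h : A → A^istr` is a pre-step, so `A` group-like ⟹ `A^istr` group-like (push forward), `Ψ A^istr = Ψ^istr A^istr`
group-like (isotropic case, seat abc-iut-L1-t11's `FrdI.OfPreSteps.isGroupLikeObj_map`), and `Ψ h` is a pre-step,
hence a base-isomorphism, along which group-likeness is reflected. [cite: MochizukiFrdI2008, Thm. 3.4 (ii) p.62] -/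
theorem isGroupLikeObj_map_of_preservesPreSteps (hF₁ : PreFrobenioid.IsFrobenioid F₁)
    (hF₂ : PreFrobenioid.IsFrobenioid F₂) (hq₁ : (ofFunctor Φ₁ F₁).IsOfQuasiIsotropicType)
    (hq₂ : (ofFunctor Φ₂ F₂).IsOfQuasiIsotropicType) (Ψ : C₁ ≌ C₂)
    (hpre : ∀ ⦃X Y : C₁⦄ (φ : X ⟶ Y), PreFrobenioid.IsPreStep F₁ φ → PreFrobenioid.IsPreStep F₂ (Ψ.functor.map φ))
    (hpre' : ∀ ⦃X Y : C₂⦄ (φ : X ⟶ Y), PreFrobenioid.IsPreStep F₂ φ → PreFrobenioid.IsPreStep F₁ (Ψ.inverse.map φ))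
    {A : C₁} (hA : PreFrobenioid.IsGroupLikeObj F₁ A) : PreFrobenioid.IsGroupLikeObj F₂ (Ψ.functor.obj A) := by
  have hP₁ := hF₁.isPreFrobenioid
  have hP₂ := hF₂.isPreFrobenioid
  -- the isotropic hull of `A`
  obtain ⟨A', h, hh⟩ := hF₁.vii_a A
  obtain ⟨-, hp, hA'i, -⟩ := id hh
  have hA' : PreFrobenioid.IsGroupLikeObj F₁ A' := FrdI.isGroupLikeObj_of_isBaseIso hP₁ h hA
  -- `Ψ^istr` and its inverse preserve pre-steps
  haveI : (PreFrobenioid.isotropicObjects F₂).IsClosedUnderIsomorphisms :=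
    ⟨fun e hX => PreFrobenioid.IsIsotropic.of_iso hP₂ e.symm hX⟩
  let Ψi : PreFrobenioid.Istr F₁ ≌ PreFrobenioid.Istr F₂ :=
    Ψ.congrFullSubcategory (FrdI.isotropicObjects_inverseImage hF₁ hq₁ hq₂ Ψ)
  have hΨi' : ∀ ⦃a b : PreFrobenioid.Istr F₂⦄ ⦃f : a ⟶ b⦄,
      PreFrobenioid.IsPreStep (PreFrobenioid.istrFunctor F₂) f →
        PreFrobenioid.IsPreStep (PreFrobenioid.istrFunctor F₁) (Ψi.inverse.map f) :=
    fun a b f hf => hpre' f.hom hf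
  -- the isotropic case on `Ψ^istr`
  have hΨA' : PreFrobenioid.IsGroupLikeObj (PreFrobenioid.istrFunctor F₂) (Ψi.functor.obj ⟨A', hA'i⟩) :=
    FrdI.OfPreSteps.isGroupLikeObj_map (PreFrobenioid.isFrobenioid_istr hF₁) (PreFrobenioid.isFrobenioid_istr hF₂)
      (fun X => PreFrobenioid.isIsotropic_istr X) (fun X => PreFrobenioid.isIsotropic_istr X) Ψi hΨi'
      (A := ⟨A', hA'i⟩) hA'
  -- reflect along the pre-step `Ψ h : Ψ A → Ψ A'`
  exact FrdI.isGroupLikeObj_of_isBaseIso' hP₂ (Ψ.functor.map h) (hpre h hp).2 hΨA'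

set_option backward.isDefEq.respectTransparency false in
/-- **[FrdI] Theorem 4.9 AS TYPED (`PreFrobenioidData.Thm49` at `ofFunctor`), in print's generality, MODULO ONLY
"`Ψ`, `Ψ⁻¹` preserve pre-steps"** (Thm. 3.4 (ii)): for Frobenioids `C_i → F_{Φ_i}` with perf-factorial `Φ_i`, `C₁`
of rational type at THE birationalization / support (`hrat₁`), and an equivalence `Ψ : C₁ ⥲ C₂` such that `Ψ` and
`Ψ⁻¹` preserve pre-steps: if the `C_i` are of rationally standard type there is an isomorphism of functors
`Ψ^Φ : Φ₁ ⥲ Φ₂` lying over `Ψ`. No hypothesis on the bases beyond print's standard type (Def. 3.1 (i)(d)).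
Proof = print's / seat abc-iut-w4-d109's assembly with the base-free transports (see the module docstring).
[cite: MochizukiFrdI2008, Thm. 4.9 p.88] -/
theorem thm49_ofFunctor_of_preservesPreSteps (hF₁ : PreFrobenioid.IsFrobenioid F₁)
    (hF₂ : PreFrobenioid.IsFrobenioid F₂)
    (hpf₁ : Objectwise (fun M _ => IsPerfFactorial M) Φ₁) (hpf₂ : Objectwise (fun M _ => IsPerfFactorial M) Φ₂)
    (hrat₁ : ∀ A : C₁, PreFrobenioidData.IsRational
      (PreFrobenioid.biratData hF₁ (PreFrobenioid.hasBiratSquares_of_isFrobenioid hF₁))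
      (S := ofFunctor Φ₁ F₁) (fun a 𝔭 => PrimarySupp a 𝔭) A)
    (Ψ : C₁ ≌ C₂)
    (hpre : ∀ ⦃X Y : C₁⦄ (φ : X ⟶ Y), PreFrobenioid.IsPreStep F₁ φ → PreFrobenioid.IsPreStep F₂ (Ψ.functor.map φ))
    (hpre' : ∀ ⦃X Y : C₂⦄ (φ : X ⟶ Y), PreFrobenioid.IsPreStep F₂ φ → PreFrobenioid.IsPreStep F₁ (Ψ.inverse.map φ))
    (R₁ : (ofFunctor Φ₁ F₁).RSParams) (R₂ : (ofFunctor Φ₂ F₂).RSParams) :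
    (ofFunctor Φ₁ F₁).Thm49 (ofFunctor Φ₂ F₂) Ψ R₁ R₂ := by
  intro hR₁ hR₂
  have hs₁ := hR₁.standard
  have hs₂ := hR₂.standard
  have hP₁ := hF₁.isPreFrobenioid
  have hP₂ := hF₂.isPreFrobenioid
  have hq₁ := hs₁.quasiIsotropic
  have hq₂ := hs₂.quasiIsotropic
  -- "Theorem 4.9 is vacuous if `C₁`, `C₂` are of group-like type": the trivial isomorphism
  by_cases hg₁ : (ofFunctor Φ₁ F₁).IsOfGroupLikeType
  · exact nonempty_divisorMonoidIsoOver_of_isOfGroupLikeType F₁ F₂ Ψ hg₁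
      ⟨fun B => (ofFunctor_isGroupLikeObj F₂ B).2 (FrdI.isGroupLikeObj_of_isBaseIso hP₂ (Ψ.counitIso.app B).hom
        (isGroupLikeObj_map_of_preservesPreSteps hF₁ hF₂ hq₁ hq₂ Ψ hpre hpre'
          ((ofFunctor_isGroupLikeObj F₁ _).1 (hg₁.obj _))))⟩
  -- non-group-like objects `N₁`, `Ψ N₁`
  obtain ⟨N₁, hN₁⟩ : ∃ A : C₁, ¬ PreFrobenioid.IsGroupLikeObj F₁ A := by
    by_contra h
    exact hg₁ ⟨fun A => (ofFunctor_isGroupLikeObj F₁ A).2 (not_exists_not.mp h A)⟩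
  have hN₂ : ¬ PreFrobenioid.IsGroupLikeObj F₂ (Ψ.functor.obj N₁) := fun h =>
    hN₁ (FrdI.isGroupLikeObj_of_isBaseIso' hP₁ (Ψ.unitIso.app N₁).hom
      (PreFrobenioid.isBaseIso_of_isIso F₁ _)
      (isGroupLikeObj_map_of_preservesPreSteps hF₂ hF₁ hq₂ hq₁ Ψ.symm (fun _ _ φ h => hpre' φ h)
        (fun _ _ φ h => hpre φ h) h))
  -- (1) the isotropifications `C_i^istr` and the restriction `Ψ^istr` (Thm. 3.4 (i), Rmk. 4.5.1)
  haveI : (PreFrobenioid.isotropicObjects F₂).IsClosedUnderIsomorphisms :=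
    ⟨fun e hX => PreFrobenioid.IsIsotropic.of_iso hP₂ e.symm hX⟩
  have hinvImg := FrdI.isotropicObjects_inverseImage hF₁ hq₁ hq₂ Ψ
  let Ψi : PreFrobenioid.Istr F₁ ≌ PreFrobenioid.Istr F₂ := Ψ.congrFullSubcategory hinvImg
  have hI₁ := PreFrobenioid.isFrobenioid_istr hF₁
  have hI₂ := PreFrobenioid.isFrobenioid_istr hF₂
  have hsI₁ := PreFrobenioid.isOfStandardType_istr hF₁ hs₁
  have hsI₂ := PreFrobenioid.isOfStandardType_istr hF₂ hs₂
  have hNI₁ := not_isGroupLikeObj_hullIstr hF₁ hN₁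
  have hNI₂ := not_isGroupLikeObj_hullIstr hF₂ hN₂
  -- `Ψ^istr` and its inverse preserve pre-steps (the pre-steps of `C^istr` are those of `C`)
  have hΨi : ∀ ⦃a b : PreFrobenioid.Istr F₁⦄ (f : a ⟶ b),
      PreFrobenioid.IsPreStep (PreFrobenioid.istrFunctor F₁) f →
        PreFrobenioid.IsPreStep (PreFrobenioid.istrFunctor F₂) (Ψi.functor.map f) :=
    fun a b f hf => hpre f.hom hf
  have hΨi' : ∀ ⦃a b : PreFrobenioid.Istr F₂⦄ (f : a ⟶ b),
      PreFrobenioid.IsPreStep (PreFrobenioid.istrFunctor F₂) f →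
        PreFrobenioid.IsPreStep (PreFrobenioid.istrFunctor F₁) (Ψi.inverse.map f) :=
    fun a b f hf => hpre' f.hom hf
  -- Thm. 3.4 (iii) for `Ψ^istr` from pre-step preservation: compatible with arrows of Frobenius type
  have hΨic : PreFrobenioid.IsFrobeniusCompatible (PreFrobenioid.istrFunctor F₁)
      (PreFrobenioid.istrFunctor F₂) Ψi.functor :=
    isFrobeniusCompatible_of_preservesPreSteps hI₁ hI₂ hsI₁.quasiIsotropic hsI₂.quasiIsotropic hsI₁.nonDilating
      hsI₂.nonDilating Ψi (fun _ _ f h => hΨi f h) (fun _ _ f h => hΨi' f h) ⟨_, hNI₁⟩ ⟨_, hNI₂⟩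
  -- (2) the setting at the perfections `(C_i^istr)^pf`, from the PRINTED hypotheses on `C_i^istr`
  have hTI : Thm42Setting (ofFunctor Φ₁ (PreFrobenioid.istrFunctor F₁)) (ofFunctor Φ₂ (PreFrobenioid.istrFunctor F₂)) :=
    ⟨⟨hsI₁, hsI₂⟩, ⟨(ofFunctor_isOfIsotropicType _).2 PreFrobenioid.isOfIsotropicType_istr,
      (ofFunctor_isOfIsotropicType _).2 PreFrobenioid.isOfIsotropicType_istr⟩,
      ⟨fun h => hNI₁ ((ofFunctor_isGroupLikeObj _ _).1 (h.obj _)),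
        fun h => hNI₂ ((ofFunctor_isGroupLikeObj _ _).1 (h.obj _))⟩⟩
  haveI := PreFrobenioid.Perfection.map_isEquivalence (hF₁ := hI₁) (hF₂ := hI₂) Ψi hΨic
  have S := FrdI.T42.setting_perfection_asPrinted Ψi hI₁ hI₂ hpf₁ hpf₂ hTI hΨic
  have hPf₁ := PreFrobenioid.Perfection.isFrobenioid hI₁
    (FrdI.T42.isFrobeniusIsotropic_of_isOfIsotropicType hI₁ PreFrobenioid.isOfIsotropicType_istr)
  have hndp₂ : IsNonDilatingOn (PreFrobenioid.Perfection.ops hI₂).monFunctor :=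
    FrdI.isNonDilatingOn_of_ofFunctor (F := (PreFrobenioid.Perfection.ops hI₂).toFunctor)
      (PreFrobenioid.Perfection.isNonDilatingOn_ops hI₂ hsI₂.nonDilating)
  -- Rmk. 4.5.1: `C₁^istr` is of rational type; Prop. 5.5 (iii): so is `(C₁^istr)^pf`
  have hratI : ∀ A : PreFrobenioid.Istr F₁, PreFrobenioidData.IsRational
      (PreFrobenioid.biratData hI₁ (PreFrobenioid.hasBiratSquares_of_isFrobenioid hI₁))
      (S := ofFunctor Φ₁ (PreFrobenioid.istrFunctor F₁)) (fun a 𝔭 => PrimarySupp a 𝔭) A :=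
    fun A => PreFrobenioid.isRational_istr_of hF₁ hrat₁ A
  have hratP : ∀ ⦃X : PreFrobenioid.Perfection hI₁⦄,
      PreFrobenioid.IsUniversallyDivFrobeniusTrivial (PreFrobenioid.Perfection.ops hI₁).toFunctor X →
        PreFrobenioidData.IsRational (PreFrobenioid.biratData S.isFrobenioid₁
          (PreFrobenioid.hasBiratSquares_of_isFrobenioid S.isFrobenioid₁))
          (S := ofFunctor _ (PreFrobenioid.Perfection.ops hI₁).toFunctor) (fun a 𝔭 => PrimarySupp a 𝔭) X :=
    fun X _ => PreFrobenioid.Perfection.isRational_perfection_of hI₁ hPf₁ hratI X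
  -- (3) Thm. 4.9 at the perfect-isotropic level (rows T49-L02/L05/L06/L07/L08′ with `Ψ^Prime`)
  obtain ⟨E', -, -, hE', -⟩ := exists_thm49_compat_perfect_primarySupp S hndp₂ hratP
  -- (4) descent along `Φ_i ↪ Φ_i^pf` to the isotropifications
  obtain ⟨EI⟩ := nonempty_divisorMonoidIsoOver_of_perfection hI₁ hI₂ Ψi hΨic hΨi' E'
    (fun X Y f hf => hE' f hf)
  -- (5) extension along isotropic hulls (row T49-L01)
  exact nonempty_divisorMonoidIsoOver_of_isotropic F₁ F₂ Ψ hF₁ hF₂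
    (fun A hA => FrdI.isIsotropic_map hq₁ hq₂ Ψ hA)
    (fun A B h hh => FrdI.isIsotropicHull_map hF₁ hF₂ hq₁ hq₂ Ψ hh)
    (fun A hA => EI.iso ⟨A, hA⟩)
    (fun A B hA hB φ x =>
      EI.natural (A := (⟨A, hA⟩ : PreFrobenioid.Istr F₁)) (B := ⟨B, hB⟩) (ObjectProperty.homMk φ) x)

end FrdI.T49

end Literature.AlgebraicGeometry.Frobenioids
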